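import Summits.BirchSwinnertonDyer.Rank1Residual.P2.CongruentNumberThetaCriterionPackage
import Summits.BirchSwinnertonDyer.Rank1Residual.P2.CongruentNumberThetaThreePrimesDescent
import HarnessLib
import HarnessLib.Audit.Tags

/-!
# Cell «bsd-monsky» (prover-B): route B's operator `θ` for ALL square-free `n ≡ 6 (mod 8)` — THE UNIFORM Θ-CRITERION
# («Tian's induction on the number of prime factors», route-B form) as ONE kernel theorem:
# `θ`-controlled ∧ `Θ(n)` odd ⟹ `𝓛(n)` odd ⟹ `ord_{s=1} L(E_n, s) = 1`, relative to the display `tyz_cmPointGaloisData`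
# (nothing asserted, nothing booked)

HONEST FRAMING (cell `bsd-monsky`, run/shared/lean/pub/bsd-monsky/; README §1/§3): the cell's CLAIMED theorem is Monsky's 1990
conjecture on the `k = 2` family `𝒮⁻`; «ℓ ≥ 3 rungs (C-P2-2 for k ≥ 3) are NOT claimed — record what the same argument gives
there, no more». THIS FILE IS PART OF THAT RECORD IN THE KERNEL, in its FINAL, UNIFORM form: the Θ-criterion of the scope note
HOME/proof/PROOF-B-K3-SCOPE.md §3 (prover-B g6) for ALL square-free `n ≡ 6 (mod 8)` at once — route B's «Tian induction on the
number of prime factors» — instead of one descent file per `k = 3` type (g8: `P2/CongruentNumberThetaThreePrimes*.lean`).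
Nothing is asserted: every statement is a kernel implication from the displayed printed sentences of
`Literature/…/TianYuanZhang2017/GenusPointDescentDisplays.lean` (`recursion`, `epsSpec`, `thm35Main`, `lemma318`, `scriptLSpec`)
and `…/CMPointGaloisDisplays.lean` (`CMBlockSpec`, `ThetaBlockSpec`, `SevenBlockSpec`, `ConjSpec` — TYZ §3.1–3.2 / Prop. 3.2 /
Thm. 3.6 / p. 759 AS PRINTED, every block) taken as data/hypotheses (the hypotheses the named fact `tyz_cmPointGaloisData`
provides); no conjecture is discharged, no count moves, no class is booked. NOT refereed; not part of PROOF-B v1.3 or of the paper.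
No new definition is introduced: the control condition, the coset predicate and the Θ-certificate are written out in full.

THE CRITERION (three files: `…ThetaCriterionCosets` = cosets, residues, square-root bookkeeping, (E5) for composite blocks;
`…ThetaCriterionPackage` = the `θ`-package for general `n`; `…ThetaCriterion` = the block induction and the theorem).
Let `n ≡ 6 (mod 8)` be square-free, `θ = θ^{(n)}` the top block's lift of `σ_{1+ϖ}` (display (G8)), `w = τ((1−i)/2)` (`2w = 0`,
`θw + w = τ(1)`). TYZ's recursion `P(d) = Z(d) − Σ_{d₀ ∈ R(d)} ε(d₀, d/d₀)𝓛(d/d₀)P(d₀)` runs over blocks `d ∣ n`, `d ≡ 5, 6, 7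
(mod 8)`; from a `6`-block the steps (block, cofactor mod 8) are `(6,1)` and `(7,2)`, from a `7`-block `(7,1)` and `(5,3)`
(`ε = ±i`), from a GOOD `5`-block (all primes `≡ 1 (mod 4)`) only `(5,1)` to good `5`-blocks. Block evaluations: (E6)
`(θ−1)Z(d) ∈ g(d)w + ℤτ(1)` for every `6`-block (J759: compare `θ^{(n)}` with `θ^{(d)}`); (E7) `(θ−1)Z(d) = 0` for every
`7`-block (Prop. 3.2 (3)); (E5) `(θ+1)Z(d) ∈ ℤτ(1)` for every good `5`-block (Thm. 3.6 (1) + `c` inverting `Cl′_d`); and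
`(θ ∓ 1)∘[i] = −[i]∘(θ ± 1)`. CONTROL in closed form: `n` is `θ`-controlled iff every `7`-block `d₀ ∣ n` with `n/d₀ ≡ 2
(mod 8)` has only good `5`-divisors (the `[3,3,7]` obstruction of the scope census and nothing else; always at `k = 2`).
VALUE: a Θ-certificate `s : ℕ → ℤ/2` with `s(e) = g(e) + Σ_{d₀ ∈ R(e), d₀ ≡ 6} 𝓛(e/d₀)s(d₀)` on the `6`-blocks `e ∣ n` with
`n/e ≡ 1 (mod 8)` (`Θ(n) := s(n)` = the sum over chains of `6`-blocks of `(∏𝓛)·g`). THEOREM (`odd_scriptL_of_thetaCert`):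
`θ`-controlled, `Θ(n) = 1`, rank `E_n(ℚ) ≤ 1` once `𝓛(n) ≠ 0` ⟹ `𝓛(n)` odd; hence `ord_{s=1} L(E_n, s) = 1` from the display
ALONE (`analyticRank_eq_one_of_thetaCert_of_cmPointGaloisData`). Instances: THEOREM B (`k = 2`, `Θ = g(2pq)`), g8's
THEOREM B₃ for `(5,5,7)` (`Θ = g(n) + 𝓛(p₁p₂)g(2p₃)`) and `(3,7,7)`.

References: [TianYuanZhang2017] §3.1 (J738–J739), Prop. 3.2 (1)(2)(3), Thm. 3.3 (ε), Thm. 3.5, Thm. 3.6 (1)(2) (J741),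
Lemma 3.18, proofs of Lemma 3.15 (J750) and Lemma 3.21 (J759), §2.1 (J725); HOME/proof/PROOF-B.md v1.3 §4–§8, §10;
HOME/proof/PROOF-B-K3-SCOPE.md §2–§5; HOME/proof/PROOF-B-THETA-CRITERION.md (this generation's companion note).

THIS FILE: §6 the block induction `theta_blocks_inW` (strong induction over the blocks `d ∣ n`: good `5`-blocks ⟹
`(θ+1)P(d) ∈ ℤτ(1)`; good `7`-blocks ⟹ `(θ−1)P(d) ∈ ℤτ(1)`; controlled `6`-blocks with `n/d ≡ 1 (mod 8)` ⟹
`(θ−1)P(d) ∈ s(d)w + ℤτ(1)`); §7 the theorem and its doors (`theta_sub_P_of_thetaControlled`, `odd_scriptL_of_thetaCert`,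
`scriptL_ne_zero_of_thetaCert`, `analyticRank_eq_one_of_thetaCert_of_cmPointGaloisData`,
`exists_odd_isScriptL_of_thetaCert_of_cmPointGaloisData`). (`even_eps_of_not` / `odd_eps_of` are g8's, from
`…ThetaThreePrimesDescent`.)
-/

noncomputable section

open scoped Classical

open WeierstrassCurve WeierstrassCurve.Affine Literature.NumberTheory.EllipticCurves
  Literature.NumberTheory.EllipticCurves.Rank1Residual
  Literature.NumberTheory.EllipticCurves.Rank1Residual.Typed
  Literature.NumberTheory.EllipticCurves.TianYuanZhang2017
  Literature.NumberTheory.EllipticCurves.TianYuanZhang2017.W2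

set_option autoImplicit false

namespace Summit.BirchSwinnertonDyer.Rank1Residual.P2

namespace ThetaDescent

variable {n : ℕ}

/-! ## §6 Soundness: the recursion under `θ ∓ 1`, by strong induction over the blocks

The VALUE `Θ` is carried as a Θ-CERTIFICATE: any `s : ℕ → ℤ/2` satisfying TYZ's recursion reduced mod `2` on the `6`-blocks
above `n` — `s(e) = g(e) + Σ_{d₀ ∈ R(e), d₀ ≡ 6 (8)} 𝓛(e/d₀)·s(d₀)` for every `6`-block `e ∣ n` with `n/e ≡ 1 (mod 8)` (these
equations determine `s` on those blocks: `Θ(n) = s(n)` is the sum over the chains of `6`-blocks `n = D₀ → D₁ → ⋯ → D_r`,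
cofactors `≡ 1 (mod 8)`, of `(∏_j 𝓛(D_{j−1}/D_j))·g(D_r)`; at `k = 2`, `Θ(n) = g(n)`; for the type `(5,5,7)`,
`Θ(n) = g(n) + 𝓛(p₁p₂)g(2p₃)`). A consumer exhibits `s` on its finitely many blocks and checks the equations. -/

/-- **The block induction** («Tian's induction on the number of prime factors», route-B form). For TYZ data `D` with the
displayed `recursion` and `epsSpec`, an automorphism `θ` with `θ(i) = −i`, the block evaluations (E5) (good `5`-blocks),
(E6) (all `6`-blocks), (E7) (all `7`-blocks), and a Θ-certificate `s`: for every block `d ∣ n`,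
* `d ≡ 5` good ⟹ `θP(d) + P(d) ∈ ℤτ(1)`;
* `d ≡ 7` good ⟹ `θP(d) − P(d) ∈ ℤτ(1)`;
* `d ≡ 6`, `n/d ≡ 1 (mod 8)`, `θ`-controlled ⟹ `θP(d) − P(d) ∈ s(d)·w + ℤτ(1)`.
(Strong induction on `d`: the sub-blocks of a good `5`-block are good `5`-blocks along `(5,1)`-steps; of a good `7`-block,
good `7`-blocks along `(7,1)`-steps and good `5`-blocks along the `(5,3)`-steps, where `ε = ±i` turns `θ − 1` into
`−[i](θ + 1)`; of a controlled `6`-block, controlled `6`-blocks along `(6,1)`-steps and good `7`-blocks along `(7,2)`-steps.)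
[cite: TianYuanZhang2017, §3.1 (p0011 L67–L73), Thm. 3.3 (p0011 L49–L51)] -/
theorem theta_blocks_inW (D : GenusPointData n) (hn0 : n ≠ 0) (hrec : D.recursion) (heps : D.epsSpec)
    (θ : D.H ≃ₐ[ℚ] D.H) (hθi : θ D.im = -D.im)
    (hE6 : ∀ d ∈ n.divisors, d % 8 = 6 →
      ∃ M : ℤ, thetaPt D θ (D.Z d) - D.Z d = (gK d : ℤ) • D.tauHalfOneMinusI + M • tauOne)
    (hE7 : ∀ d ∈ n.divisors, d % 8 = 7 → thetaPt D θ (D.Z d) = D.Z d)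
    (hE5 : ∀ d ∈ n.divisors, d % 8 = 5 → (∀ p ∈ d.primeFactors, p % 4 = 1) →
      thetaPt D θ (D.Z d) + D.Z d ∈ AddSubgroup.zmultiples (tauOne : APoint D.H))
    (s : ℕ → ZMod 2)
    (hs : ∀ e ∈ n.divisors, e % 8 = 6 → (n / e) % 8 = 1 →
      s e = (gK e : ZMod 2) +
        ∑ d₀ ∈ (recursionIndex e).filter (fun d₀ => d₀ % 8 = 6), (D.scriptL (e / d₀) : ZMod 2) * s d₀) :
    ∀ d ∈ n.divisors,
      (d % 8 = 5 → (∀ p ∈ d.primeFactors, p % 4 = 1) →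
        ∃ M : ℤ, thetaPt D θ (D.P d) + D.P d = (0 : ℤ) • D.tauHalfOneMinusI + M • tauOne) ∧
      (d % 8 = 7 → (∀ d' ∈ d.divisors, d' % 8 = 5 → ∀ p ∈ d'.primeFactors, p % 4 = 1) →
        ∃ M : ℤ, thetaPt D θ (D.P d) - D.P d = (0 : ℤ) • D.tauHalfOneMinusI + M • tauOne) ∧
      (d % 8 = 6 → (n / d) % 8 = 1 →
        (∀ d₀ ∈ d.divisors, d₀ % 8 = 7 → (d / d₀) % 8 = 2 → ∀ d' ∈ d₀.divisors, d' % 8 = 5 →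
          ∀ p ∈ d'.primeFactors, p % 4 = 1) →
        ∃ M : ℤ, thetaPt D θ (D.P d) - D.P d = ((s d).val : ℤ) • D.tauHalfOneMinusI + M • tauOne) := by
  intro d
  induction d using Nat.strong_induction_on with
  | _ d ih =>
  intro hd
  obtain ⟨hdn, -⟩ := Nat.mem_divisors.mp hd
  have hd0 : d ≠ 0 := fun h => hn0 (Nat.eq_zero_of_zero_dvd (h ▸ hdn))
  have hsub : ∀ d₀ ∈ recursionIndex d, d₀ ∈ n.divisors ∧ d₀ < d ∧ d₀ ∣ d := fun d₀ h₀ =>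
    ⟨Nat.mem_divisors.mpr ⟨(Nat.mem_divisors.mp (mem_recursionIndex_iff.mp h₀).1).1.trans hdn, hn0⟩,
      lt_of_mem_recursionIndex h₀, (Nat.mem_divisors.mp (mem_recursionIndex_iff.mp h₀).1).1⟩
  -- the terms of the recursion
  set T : ℕ → APoint D.H := fun d₀ =>
    cmIPow D.im D.im_sq (D.eps d₀ (d / d₀)) (D.scriptL (d / d₀) • D.P d₀) with hT
  have hsplit_sub : ∀ (hP : D.P d = D.Z d - ∑ d₀ ∈ recursionIndex d, T d₀),
      thetaPt D θ (D.P d) - D.P d =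
        (thetaPt D θ (D.Z d) - D.Z d) - ∑ d₀ ∈ recursionIndex d, (thetaPt D θ (T d₀) - T d₀) := by
    intro hP
    rw [hP, map_sub, map_sum, Finset.sum_sub_distrib]; abel
  have e0 : (0 : ℤ) + ∑ _x ∈ recursionIndex d, (0 : ℤ) = 0 := by simp
  refine ⟨fun hd5 hgood => ?_, fun hd7 hsg => ?_, fun hd6 hq1 hctrl => ?_⟩
  · -- a good `5`-block
    have hP : D.P d = D.Z d - ∑ d₀ ∈ recursionIndex d, T d₀ := hrec d hd (Or.inl hd5)
    have hsplit : thetaPt D θ (D.P d) + D.P d =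
        (thetaPt D θ (D.Z d) + D.Z d) - ∑ d₀ ∈ recursionIndex d, (thetaPt D θ (T d₀) + T d₀) := by
      rw [hP, map_sub, map_sum, Finset.sum_add_distrib]; abel
    rw [hsplit]
    have hZ := inW_zero_of_mem D (hE5 d hd hd5 hgood)
    have hS : ∃ M : ℤ, ∑ d₀ ∈ recursionIndex d, (thetaPt D θ (T d₀) + T d₀) =
        (∑ _d₀ ∈ recursionIndex d, (0 : ℤ)) • D.tauHalfOneMinusI + M • tauOne := by
      refine inW_sum D _ _ _ fun d₀ h₀ => ?_
      obtain ⟨hd₀n, hlt, -⟩ := hsub d₀ h₀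
      obtain ⟨h₀5, hc1, hgood₀⟩ := sub_of_fiveGood hgood h₀
      have he : Even (D.eps d₀ (d / d₀)) := even_eps_of_not D heps (by omega)
      have hIH := (ih d₀ hlt hd₀n).1 h₀5 hgood₀
      have := inW_cmIPow D (D.eps d₀ (d / d₀)) (inW_zsmul D (D.scriptL (d / d₀)) hIH)
      rw [mul_zero] at this
      simp only [hT, theta_add_cmIPow_even D θ hθi he]
      exact this
    have := inW_sub D hZ hS
    rw [e0] at this
    exact this
  · -- a good `7`-block
    have hP : D.P d = D.Z d - ∑ d₀ ∈ recursionIndex d, T d₀ := hrec d hd (Or.inr (Or.inr hd7))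
    rw [hsplit_sub hP]
    have hZ : ∃ M : ℤ, thetaPt D θ (D.Z d) - D.Z d = (0 : ℤ) • D.tauHalfOneMinusI + M • tauOne := by
      rw [hE7 d hd hd7, sub_self]; exact inW_zero D
    have hS : ∃ M : ℤ, ∑ d₀ ∈ recursionIndex d, (thetaPt D θ (T d₀) - T d₀) =
        (∑ _d₀ ∈ recursionIndex d, (0 : ℤ)) • D.tauHalfOneMinusI + M • tauOne := by
      refine inW_sum D _ _ _ fun d₀ h₀ => ?_
      obtain ⟨hd₀n, hlt, hdvd⟩ := hsub d₀ h₀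
      rcases sub_of_seven hd7 h₀ with ⟨h₀7, hc1⟩ | ⟨h₀5, hc3⟩
      · have he : Even (D.eps d₀ (d / d₀)) := even_eps_of_not D heps (by omega)
        have hsg₀ : ∀ d' ∈ d₀.divisors, d' % 8 = 5 → ∀ p ∈ d'.primeFactors, p % 4 = 1 := fun d' hd' h5 =>
          hsg d' (Nat.mem_divisors.mpr ⟨(Nat.mem_divisors.mp hd').1.trans hdvd, hd0⟩) h5
        have hIH := (ih d₀ hlt hd₀n).2.1 h₀7 hsg₀
        have := inW_cmIPow D (D.eps d₀ (d / d₀)) (inW_zsmul D (D.scriptL (d / d₀)) hIH)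
        rw [mul_zero] at this
        simp only [hT, theta_sub_cmIPow_even D θ hθi he]
        exact this
      · have he : Odd (D.eps d₀ (d / d₀)) := odd_eps_of D heps h₀5 hc3
        have hgood₀ : ∀ p ∈ d₀.primeFactors, p % 4 = 1 := hsg d₀ (Nat.mem_divisors.mpr ⟨hdvd, hd0⟩) h₀5
        have hIH := (ih d₀ hlt hd₀n).1 h₀5 hgood₀
        have := inW_neg D (inW_cmIPow D (D.eps d₀ (d / d₀)) (inW_zsmul D (D.scriptL (d / d₀)) hIH))
        rw [mul_zero] at this
        simp only [hT, theta_sub_cmIPow_odd D θ hθi he]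
        exact this
    have := inW_sub D hZ hS
    rw [e0] at this
    exact this
  · -- a controlled `6`-block with `n/d ≡ 1 (mod 8)`
    have hP : D.P d = D.Z d - ∑ d₀ ∈ recursionIndex d, T d₀ := hrec d hd (Or.inr (Or.inl hd6))
    rw [hsplit_sub hP]
    have hZ := hE6 d hd hd6
    set b : ℕ → ℤ := fun d₀ => if d₀ % 8 = 6 then D.scriptL (d / d₀) * ((s d₀).val : ℤ) else 0 with hb
    have hS : ∃ M : ℤ, ∑ d₀ ∈ recursionIndex d, (thetaPt D θ (T d₀) - T d₀) =
        (∑ d₀ ∈ recursionIndex d, b d₀) • D.tauHalfOneMinusI + M • tauOne := by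
      refine inW_sum D _ _ _ fun d₀ h₀ => ?_
      obtain ⟨hd₀n, hlt, hdvd⟩ := hsub d₀ h₀
      have hd₀pos : 0 < d₀ := Nat.pos_of_dvd_of_pos hdvd (Nat.pos_of_ne_zero hd0)
      rcases sub_of_six hd6 h₀ with ⟨h₀6, hc1⟩ | ⟨h₀7, hc2⟩
      · have he : Even (D.eps d₀ (d / d₀)) := even_eps_of_not D heps (by omega)
        -- the cofactor of `d₀` in `n` is again `≡ 1 (mod 8)`, and `d₀` is again `θ`-controlled
        have hnd₀ : n / d₀ = (d / d₀) * (n / d) :=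
          Nat.div_eq_of_eq_mul_right hd₀pos (by rw [← mul_assoc, Nat.mul_div_cancel' hdvd, Nat.mul_div_cancel' hdn])
        have hq1₀ : (n / d₀) % 8 = 1 := by rw [hnd₀, Nat.mul_mod, hc1, hq1]
        have hctrl₀ : ∀ e ∈ d₀.divisors, e % 8 = 7 → (d₀ / e) % 8 = 2 → ∀ d' ∈ e.divisors, d' % 8 = 5 →
            ∀ p ∈ d'.primeFactors, p % 4 = 1 := by
          intro e he₀ he7 hq2
          obtain ⟨hed₀, -⟩ := Nat.mem_divisors.mp he₀
          have hepos : 0 < e := Nat.pos_of_dvd_of_pos hed₀ hd₀pos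
          refine hctrl e (Nat.mem_divisors.mpr ⟨hed₀.trans hdvd, hd0⟩) he7 ?_
          have hde : d / e = (d₀ / e) * (d / d₀) :=
            Nat.div_eq_of_eq_mul_right hepos (by rw [← mul_assoc, Nat.mul_div_cancel' hed₀, Nat.mul_div_cancel' hdvd])
          rw [hde, Nat.mul_mod, hq2, hc1]
        have hIH := (ih d₀ hlt hd₀n).2.2 h₀6 hq1₀ hctrl₀
        have := inW_cmIPow D (D.eps d₀ (d / d₀)) (inW_zsmul D (D.scriptL (d / d₀)) hIH)
        have hb₀ : b d₀ = D.scriptL (d / d₀) * ((s d₀).val : ℤ) := if_pos h₀6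
        rw [hb₀]
        simp only [hT, theta_sub_cmIPow_even D θ hθi he]
        exact this
      · have he : Even (D.eps d₀ (d / d₀)) := even_eps_of_not D heps (by omega)
        have hsg₀ : ∀ d' ∈ d₀.divisors, d' % 8 = 5 → ∀ p ∈ d'.primeFactors, p % 4 = 1 :=
          hctrl d₀ (Nat.mem_divisors.mpr ⟨hdvd, hd0⟩) h₀7 hc2
        have hIH := (ih d₀ hlt hd₀n).2.1 h₀7 hsg₀
        have := inW_cmIPow D (D.eps d₀ (d / d₀)) (inW_zsmul D (D.scriptL (d / d₀)) hIH)
        rw [mul_zero] at this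
        have hb₀ : b d₀ = 0 := if_neg (by omega)
        rw [hb₀]
        simp only [hT, theta_sub_cmIPow_even D θ hθi he]
        exact this
    refine inW_of_intCast_eq D (inW_sub D hZ hS) ?_
    -- `g(d) + Σ_{d₀ ≡ 6} 𝓛(d/d₀)s(d₀) ≡ s(d) (mod 2)`
    rw [Int.cast_natCast, ZMod.natCast_zmod_val, hs d hd hd6 hq1, Int.cast_add, Int.cast_natCast, Int.cast_sum,
      Finset.sum_filter]
    congr 1
    refine Finset.sum_congr rfl fun d₀ _ => ?_
    by_cases h₀6 : d₀ % 8 = 6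
    · simp only [hb, h₀6, if_true, Int.cast_mul, Int.cast_natCast, ZMod.natCast_zmod_val]
    · simp only [hb, h₀6, if_false, Int.cast_zero]

/-! ## §7 THE UNIFORM Θ-CRITERION -/

/-- **The recursion side for general `n`**: for square-free `θ`-controlled `n ≡ 6 (mod 8)`, TYZ data with the displayed
sentences and a Θ-certificate `s`, the top block's `θ = θ^{(n)}` has `θ(√−n) = √−n`, `θ(i) = −i`, `θ(√−2) = −√−2` and
`(θ − 1)P(n) = s(n)·τ((1−i)/2) + M·τ(1)` (`s(n) = Θ(n) ∈ {0, 1}`).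
[cite: TianYuanZhang2017, §3.1 (J738–J739, p0011 L67–L73), Prop. 3.2, Thm. 3.6 (J741), proof of Lemma 3.21 (J759)] -/
theorem theta_sub_P_of_thetaControlled (hsq : Squarefree n) (h6 : n % 8 = 6) (D : GenusPointData n) (hD : D.Printed)
    (hG : D.CMPointGaloisPrinted)
    (hctrl : ∀ d₀ ∈ n.divisors, d₀ % 8 = 7 → (n / d₀) % 8 = 2 → ∀ d' ∈ d₀.divisors, d' % 8 = 5 →
      ∀ p ∈ d'.primeFactors, p % 4 = 1)
    (s : ℕ → ZMod 2)
    (hs : ∀ e ∈ n.divisors, e % 8 = 6 → (n / e) % 8 = 1 →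
      s e = (gK e : ZMod 2) +
        ∑ d₀ ∈ (recursionIndex e).filter (fun d₀ => d₀ % 8 = 6), (D.scriptL (e / d₀) : ZMod 2) * s d₀) :
    ∃ θ : D.H ≃ₐ[ℚ] D.H, θ (D.sqrtNeg n) = D.sqrtNeg n ∧ θ D.im = -D.im ∧ θ (D.sqrtNeg 2) = -D.sqrtNeg 2 ∧
      ∃ M : ℤ, thetaPt D θ (D.P n) - D.P n = ((s n).val : ℤ) • D.tauHalfOneMinusI + M • tauOne := by
  obtain ⟨-, heps, hrec, -⟩ := hD
  obtain ⟨θ, hθK, hθi, hθ2, hE6, hE7, hE5⟩ := theta_package hsq h6 D hG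
  have hn0 : n ≠ 0 := hsq.ne_zero
  have hn : n ∈ n.divisors := Nat.mem_divisors_self _ hn0
  have hq1 : (n / n) % 8 = 1 := by rw [Nat.div_self (Nat.pos_of_ne_zero hn0)]
  exact ⟨θ, hθK, hθi, hθ2, (theta_blocks_inW D hn0 hrec heps θ hθi hE6 hE7 hE5 s hs n hn).2.2 h6 hq1 hctrl⟩

/-- **THE UNIFORM Θ-CRITERION in the kernel** (PROOF-B §8 for ALL square-free `n ≡ 6 (mod 8)`; «Tian's induction on the
number of prime factors», route-B form; the scope note's Θ-criterion with its control condition in closed form). For square-free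
`n ≡ 6 (mod 8)`, TYZ data `D` with `D.Printed` and `D.CMPointGaloisPrinted` (the hypotheses the Literature named fact
`tyz_cmPointGaloisData` provides) and rank `E_n(ℚ) ≤ 1` once `𝓛(n) ≠ 0` (`hr`): if `n` is `θ`-CONTROLLED (every `7`-block
`d₀ ∣ n` with `n/d₀ ≡ 2 (mod 8)` has only `5`-divisors whose primes are `≡ 1 (mod 4)`) and `Θ(n) = s(n)` is ODD for a
Θ-certificate `s` (`s(e) ≡ g(e) + Σ_{d₀ ∈ R(e), d₀ ≡ 6} 𝓛(e/d₀)s(d₀)` on the `6`-blocks `e ∣ n` with `n/e ≡ 1 (mod 8)`), then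
`𝓛(n)` is ODD. Instances: THEOREM B (`k = 2`, `𝒮⁻`: `Θ = g(2pq)`), THEOREM B₃ for `(5,5,7)` (`Θ = g(n) + 𝓛(p₁p₂)g(2p₃)`) and
`(3,7,7)`. Nothing asserted; CONDITIONAL on the display; NOT refereed, not part of PROOF-B v1.3.
[cite: TianYuanZhang2017, Thm. 3.5 (p0011 L94–L112), Thm. 3.6 (2) (J741), Lemma 3.18 (p0017 L152–L153), §3.1 (p0011 L67–L73), proof of Lemma 3.21 (J759)] -/
theorem odd_scriptL_of_thetaCert (hsq : Squarefree n) (h6 : n % 8 = 6) (D : GenusPointData n) (hD : D.Printed)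
    (hG : D.CMPointGaloisPrinted)
    (hr :
      letI := isElliptic_congruentNumberCurve hsq.ne_zero
      D.scriptL n ≠ 0 → (congruentNumberCurve n).mordellWeilRank ≤ 1)
    (hctrl : ∀ d₀ ∈ n.divisors, d₀ % 8 = 7 → (n / d₀) % 8 = 2 → ∀ d' ∈ d₀.divisors, d' % 8 = 5 →
      ∀ p ∈ d'.primeFactors, p % 4 = 1)
    (s : ℕ → ZMod 2)
    (hs : ∀ e ∈ n.divisors, e % 8 = 6 → (n / e) % 8 = 1 →
      s e = (gK e : ZMod 2) +
        ∑ d₀ ∈ (recursionIndex e).filter (fun d₀ => d₀ % 8 = 6), (D.scriptL (e / d₀) : ZMod 2) * s d₀)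
    (hΘ : s n = 1) : Odd (D.scriptL n) := by
  obtain ⟨θ, hθK, hθi, hθ2, M, hM⟩ := theta_sub_P_of_thetaControlled hsq h6 D hD hG hctrl s hs
  obtain ⟨hLspec, -, -, -, h35, -, -, -, h318, -, -⟩ := hD
  rw [hΘ, ZMod.val_one, Nat.cast_one] at hM
  obtain ⟨hw2, hww⟩ := bZero D θ hθi
  exact odd_scriptL_of_theta_rec hsq h6 D hLspec h35 h318 hr θ hθK hθi hθ2 (Or.inl hw2) hww hM odd_one

/-- **`𝓛(n) ≠ 0` under the Θ-criterion — NO rank input** (if `𝓛(n) = 0` the rank hypothesis is vacuous).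
[cite: TianYuanZhang2017, Thm. 3.5 (p0011 L94–L95: 𝓛(n) = 0 ⟹ 𝒫(n) = 0), Lemma 3.18] -/
theorem scriptL_ne_zero_of_thetaCert (hsq : Squarefree n) (h6 : n % 8 = 6) (D : GenusPointData n) (hD : D.Printed)
    (hG : D.CMPointGaloisPrinted)
    (hctrl : ∀ d₀ ∈ n.divisors, d₀ % 8 = 7 → (n / d₀) % 8 = 2 → ∀ d' ∈ d₀.divisors, d' % 8 = 5 →
      ∀ p ∈ d'.primeFactors, p % 4 = 1)
    (s : ℕ → ZMod 2)
    (hs : ∀ e ∈ n.divisors, e % 8 = 6 → (n / e) % 8 = 1 →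
      s e = (gK e : ZMod 2) +
        ∑ d₀ ∈ (recursionIndex e).filter (fun d₀ => d₀ % 8 = 6), (D.scriptL (e / d₀) : ZMod 2) * s d₀)
    (hΘ : s n = 1) : D.scriptL n ≠ 0 := by
  intro h0
  have h := odd_scriptL_of_thetaCert hsq h6 D hD hG (fun h => absurd h0 h) hctrl s hs hΘ
  rw [h0] at h
  exact (Int.not_odd_iff_even.mpr Even.zero) h

/-- **Clause (a) under the Θ-criterion, from the Literature display ALONE**: for square-free, `θ`-controlled
`n ≡ 6 (mod 8)` admitting, for every admissible data, a Θ-certificate with `Θ(n)` odd: `ord_{s=1} L(E_n, s) = 1`.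
No GZK, no Selmer input, no genus-sum hypothesis. CONDITIONAL on `tyz_cmPointGaloisData`; nothing asserted.
[cite: TianYuanZhang2017, §1 (definition of 𝓛(n), p0002 L46–L75), §3] -/
theorem analyticRank_eq_one_of_thetaCert_of_cmPointGaloisData (hCM : tyz_cmPointGaloisData) (hsq : Squarefree n)
    (h6 : n % 8 = 6)
    (hctrl : ∀ d₀ ∈ n.divisors, d₀ % 8 = 7 → (n / d₀) % 8 = 2 → ∀ d' ∈ d₀.divisors, d' % 8 = 5 →
      ∀ p ∈ d'.primeFactors, p % 4 = 1)
    (hΘ : ∀ D : GenusPointData n, D.Printed → D.CMPointGaloisPrinted → ∃ s : ℕ → ZMod 2,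
      (∀ e ∈ n.divisors, e % 8 = 6 → (n / e) % 8 = 1 →
        s e = (gK e : ZMod 2) +
          ∑ d₀ ∈ (recursionIndex e).filter (fun d₀ => d₀ % 8 = 6), (D.scriptL (e / d₀) : ZMod 2) * s d₀) ∧
      s n = 1) :
    (congruentNumberCurve n).analyticRank = 1 := by
  obtain ⟨D, hD, hG⟩ := hCM _ hsq (Or.inr (Or.inl h6))
  have hL : IsScriptL _ (D.scriptL n) := hD.1 _ (Nat.mem_divisors_self _ hsq.ne_zero) (by omega)
  obtain ⟨s, hs, hΘn⟩ := hΘ D hD hG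
  exact analyticRank_congruentNumberCurve_eq_one_of_isScriptL hsq (Or.inr (Or.inl h6)) hL
    (scriptL_ne_zero_of_thetaCert hsq h6 D hD hG hctrl s hs hΘn)

/-- **Output shape under the Θ-criterion**: an ODD integer `L` with `L² = 𝓛(n)²`, relative to {`tyz_cmPointGaloisData`, GZK}.
CONDITIONAL; nothing asserted. [cite: TianYuanZhang2017, Thm. 3.5 and §3] -/
theorem exists_odd_isScriptL_of_thetaCert_of_cmPointGaloisData (hCM : tyz_cmPointGaloisData)
    (hGZK : rank_eq_analyticRank_of_analyticRank_le_one) (hsq : Squarefree n) (h6 : n % 8 = 6)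
    (hctrl : ∀ d₀ ∈ n.divisors, d₀ % 8 = 7 → (n / d₀) % 8 = 2 → ∀ d' ∈ d₀.divisors, d' % 8 = 5 →
      ∀ p ∈ d'.primeFactors, p % 4 = 1)
    (hΘ : ∀ D : GenusPointData n, D.Printed → D.CMPointGaloisPrinted → ∃ s : ℕ → ZMod 2,
      (∀ e ∈ n.divisors, e % 8 = 6 → (n / e) % 8 = 1 →
        s e = (gK e : ZMod 2) +
          ∑ d₀ ∈ (recursionIndex e).filter (fun d₀ => d₀ % 8 = 6), (D.scriptL (e / d₀) : ZMod 2) * s d₀) ∧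
      s n = 1) :
    ∃ L : ℤ, Odd L ∧ IsScriptL n L := by
  haveI := isElliptic_congruentNumberCurve hsq.ne_zero
  obtain ⟨D, hD, hG⟩ := hCM _ hsq (Or.inr (Or.inl h6))
  have hL : IsScriptL _ (D.scriptL n) := hD.1 _ (Nat.mem_divisors_self _ hsq.ne_zero) (by omega)
  obtain ⟨s, hs, hΘn⟩ := hΘ D hD hG
  refine ⟨_, odd_scriptL_of_thetaCert hsq h6 D hD hG (fun hL0 => ?_) hctrl s hs hΘn, hL⟩
  have har := S4 hsq (Or.inr (Or.inl h6)) hL hL0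
  rw [(hGZK (congruentNumberCurve n) har).1]; exact har

end ThetaDescent

end Summit.BirchSwinnertonDyer.Rank1Residual.P2

end
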